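import Literature.NumberTheory.EllipticCurves.Gross2004.RationalCharacterRamifiedProofs
import Literature.NumberTheory.EllipticCurves.RankinSelbergBaseChangeLocalFactorProofs
import HarnessLib

/-!
# Gross's factorisation `L(f, χ, s) = L(A₁, s) L(A₂, s)`, LOCAL step: the Rankin–Selberg factors
# over `v ∣ p` against a rational ring class character multiply to the `p`-factors of the twists

Topic `NumberTheory/EllipticCurves`, paper namespace `Literature.NumberTheory.EllipticCurves.Gross2004`;
theorems only (no definition, no named fact). Third step of the discharge of the named fact
`Gross2004.rankinLSeries_eq_mul_quadraticTwist` (`RationalCharacterLSeries.lean`; Gross 2004,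
MSRI Publ. 49, §2 p. 40: for a rational ring class character `χ` of the order of conductor `c`,
"corresponding to a factorization `D = d₁ d₂` into two fundamental discriminants",
`L(f, χ, s) = L(A₁, s) L(A₂, s)`), prime by prime on the side of the Rankin–Selberg Euler
product IN GALOIS CURRENCY (`rankinSelbergLocalFactorInv f χ_gal v s`, `RankinSelbergLFunctionK.lean`,
Nekovář 1995 (0.5)):

* `rankinSelbergLocalFactorInv_of_absNorm_eq_pow`, `finprod_rankinSelbergLocalFactorInv_eq_of_heckeValueAt`
  — the Galois-currency twins of the tree's Hecke-currency bookkeeping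
  (`RankinSelbergBaseChangeLocalFactorProofs.lean`: `…Hecke_of_absNorm_eq_pow`,
  `finprod_rankinSelbergLocalFactorInv_eq_of_heckeValue`): if `heckeValueAt χ v = w^{f_v}` at
  every `v ∣ p` then `∏_{v ∣ p} F_v(s)⁻¹ = E(w) · E(w κ(p))` with
  `E(t) = (1 − t a_p p^{−s} + e t² p^{−2s})⁻¹`, `e = p 𝟙_{p∤N}`, `κ` the Kronecker character of
  `K` (split / inert / ramified: `split_localFactor_sq`, `inert_localFactor_mul`, second factor `1`).
* `finprod_rankinSelbergLocalFactorInv_genus` — **for the rational character `χ_gal` of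
  `D = d₁ d₂ = d_K c²`: `∏_{v ∣ p} F_v(s)⁻¹ = E(t₁(p)) · E(t₂(p))`** at EVERY prime `p`, where
  `tᵢ(p) ∈ {0, ±1}` is the `p`-value of the Kronecker character of `ℚ(√dᵢ)`:
  `tᵢ(p) = (dᵢ / p)` (Jacobi symbol `J(dᵢ | p)`) for odd `p`, and for `p = 2`: `0` if `dᵢ` is even,
  `+1` if `dᵢ ≡ 1 (mod 8)`, `−1` if `dᵢ ≡ 5 (mod 8)`. The Galois-currency values feeding the first
  lemma come from the two predecessors: `(d₁ / N v)` at `v ∤ 2 d₁ c`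
  (`heckeValueAt_eq_jacobiSym_of_isRationalCharacterFor`), the dyadic sign at `v ∣ 2` for odd
  `d₁` (`heckeValueAt_of_isRationalCharacterFor_two`), the same with `d₂` in place of `d₁` at the
  ramified primes dividing `d₁` but not `c` (symmetry `IsRationalCharacterFor.of_mul_eq_sq`), and
  `0` above `c` (`heckeValueAt_eq_zero_of_isRationalCharacterFor_of_dvd_conductor`); the matching
  `{w, wκ(p)} = {t₁(p), t₂(p)}` is `(d₁/p)(d₂/p) = (d_K c²/p)` (odd `p`) and `d₁ d₂ ≡ d_K (mod 8)`
  (`p = 2`, `c` odd).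

These `E(tᵢ(p))` are the `p`-Euler factors of `L(A_i, s) = L(E^{(dᵢ)}, s)` (sequel
`QuadraticTwistEulerFactorsProofs.lean`), whence the global identity by regrouping the Euler
product over the places of `K` (sequel `RationalCharacterLSeriesHolds.lean`).

## References

* [Gross2004] B. H. Gross, *Heegner points and representation theory*, MSRI Publ. 49 (2004), §2
  p. 40 and §3 (p. 40), §13 (p. 49).
* [Nekovar1995] J. Nekovář, Math. Ann. 302 (1995), (0.5) p. 611, §3.4.
* [NeukirchANT1999] J. Neukirch, *Algebraic Number Theory* (1999), Ch. I §8 Prop. (8.5)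
  (decomposition law in quadratic fields), Ch. VII (10.4) (iv).
* [Cox2013] D. A. Cox, *Primes of the form x² + ny²*, 2nd ed., §5.B Prop. 5.16, §1.C Lemma 1.14.
-/

noncomputable section

open scoped MatrixGroups ModularForm NumberTheorySymbols NumberField
open Module NumberField Ideal IsDedekindDomain CongruenceSubgroup Field
open Literature.NumberTheory.GaloisRepresentations
open Literature.NumberTheory.EllipticCurves.ModularForms
open Literature.NumberTheory.QuadraticFields

namespace Literature.NumberTheory.EllipticCurves

namespace Gross2004

universe u

/-! ## The Rankin–Selberg local factors in Galois currency, over the places above `p` -/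

section Port

variable {K : Type u} [Field K] [NumberField K] {N : ℕ}

/-- `(p^d)^{s} = (p^{s})^d` for natural `p`, `d`. [folklore] -/
private theorem natCast_pow_cpow (p d : ℕ) (s : ℂ) :
    (((p ^ d : ℕ) : ℂ)) ^ s = (((p : ℕ) : ℂ) ^ s) ^ d := by
  induction d with
  | zero => rw [pow_zero, pow_zero, Nat.cast_one, Complex.one_cpow]
  | succ d ih => rw [pow_succ, Nat.cast_mul, Complex.natCast_mul_natCast_cpow, ih, pow_succ]

/-- The deviation of the Galois-currency local factor from `1`, unfolded (`q = N(v)`,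
`ℓ = q.minFac`, `k = q.factorization ℓ`, `e = ℓ 𝟙_{ℓ∤N}`, `w = heckeValueAt χ v`).
[cite: Nekovar1995, (0.5) p. 611 and §3.4] -/
theorem rankinSelbergLocalFactorInv_eq_one_sub (f : CuspForm (Gamma0 N) 2)
    (χ : absoluteGaloisGroup K →ₜ* ℂˣ) (v : HeightOneSpectrum (𝓞 K)) (s : ℂ) :
    rankinSelbergLocalFactorInv f χ v s = 1 -
      (frobTracePow (cuspCoeff f (absNorm v.asIdeal).minFac)
          (if (absNorm v.asIdeal).minFac ∣ N then 0 else ((absNorm v.asIdeal).minFac : ℂ))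
          ((absNorm v.asIdeal).factorization (absNorm v.asIdeal).minFac) *
        heckeValueAt χ v * ((absNorm v.asIdeal : ℕ) : ℂ) ^ (-s) -
      (if (absNorm v.asIdeal).minFac ∣ N then 0 else ((absNorm v.asIdeal).minFac : ℂ)) ^
          ((absNorm v.asIdeal).factorization (absNorm v.asIdeal).minFac) *
        heckeValueAt χ v ^ 2 * ((absNorm v.asIdeal : ℕ) : ℂ) ^ (-2 * s)) := by
  rw [rankinSelbergLocalFactorInv]
  ring

/-- **The Rankin–Selberg local factor (Galois currency) at a place of residue degree `d` over
`p`**: if `N(v) = p^d` (`p` prime, `d ≥ 1`) then, with `w = heckeValueAt χ v`, `X = p^{−s}`,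
`e = p·𝟙_{p ∤ N}`: `F_v(s) = 1 − (α^d + β^d) w X^d + e^d w² X^{2d}`.
[cite: Nekovar1995, (0.5) p. 611 and §3.4] -/
theorem rankinSelbergLocalFactorInv_of_absNorm_eq_pow (f : CuspForm (Gamma0 N) 2)
    (χ : absoluteGaloisGroup K →ₜ* ℂˣ) {v : HeightOneSpectrum (𝓞 K)} {p d : ℕ} (hp : p.Prime)
    (hd : d ≠ 0) (hv : absNorm v.asIdeal = p ^ d) (s : ℂ) :
    rankinSelbergLocalFactorInv f χ v s =
      1 - frobTracePow (cuspCoeff f p) (if p ∣ N then 0 else (p : ℂ)) d * heckeValueAt χ v *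
          ((p : ℂ) ^ (-s)) ^ d +
        (if p ∣ N then 0 else (p : ℂ)) ^ d * heckeValueAt χ v ^ 2 *
          (((p : ℂ) ^ (-s)) ^ d) ^ 2 := by
  have hmin : (p ^ d).minFac = p := by rw [Nat.pow_minFac hd, hp.minFac_eq]
  have hfac : (p ^ d).factorization p = d := by
    rw [Nat.factorization_pow, Finsupp.smul_apply, hp.factorization_self, smul_eq_mul, mul_one]
  have h2s : (((p ^ d : ℕ) : ℂ)) ^ (-2 * s) = ((((p : ℕ) : ℂ) ^ (-s)) ^ d) ^ 2 := by
    rw [show (-2 * s : ℂ) = ((2 : ℕ) : ℂ) * (-s) by push_cast; ring, Complex.cpow_nat_mul,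
      natCast_pow_cpow]
  rw [rankinSelbergLocalFactorInv_eq_one_sub, hv, hmin, hfac, natCast_pow_cpow, h2s]
  ring

/-- **Local Artin formalism for `f` over a quadratic field, Galois currency.** Let `[K : ℚ] = 2`,
`κ` a Dirichlet character with the Kronecker values of `K`, `p` a prime, `f ∈ S₂(Γ₀(N))`, `χ` ANY
continuous character `Γ_K → ℂˣ` and `w ∈ ℂ` such that `heckeValueAt χ v = w^{f_v}` at every
place `v ∣ p` (`N(v) = p^{f_v}`). Then
`∏_{v ∣ p} F_v(s)⁻¹ = (1 − a_p w p^{−s} + e w² p^{−2s})⁻¹ · (1 − a_p (wκ(p)) p^{−s} + e (wκ(p))² p^{−2s})⁻¹`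
(`e = p·𝟙_{p ∤ N}`; split: the square; inert: `inert_localFactor_mul`; ramified: second factor
`1`). The Galois-currency twin of `finprod_rankinSelbergLocalFactorInv_eq_of_heckeValue`.
[cite: Gross2004, §3 (p. 40) and §13 (p. 49)] [cite: NeukirchANT1999, Ch. VII (10.4) (iv)] -/
theorem finprod_rankinSelbergLocalFactorInv_eq_of_heckeValueAt (h2 : finrank ℚ K = 2) {M : ℕ}
    (κ : DirichletCharacter ℂ M)
    (hoddp : ∀ p : ℕ, p.Prime → p ≠ 2 → κ p = (J(NumberField.discr K | p) : ℂ))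
    (htwo : κ 2 = if NumberField.discr K % 8 = 1 then 1
      else if NumberField.discr K % 8 = 5 then -1 else 0)
    (f : CuspForm (Gamma0 N) 2) (χ : absoluteGaloisGroup K →ₜ* ℂˣ) {p : ℕ} (hp : p.Prime)
    (w s : ℂ)
    (hval : ∀ v : HeightOneSpectrum (𝓞 K), v.asIdeal ∈ primesOver (span {(p : ℤ)}) (𝓞 K) →
      heckeValueAt χ v = w ^ (absNorm v.asIdeal).factorization p) :
    ∏ᶠ v ∈ HeightOneSpectrum.asIdeal ⁻¹' primesOver (span {(p : ℤ)}) (𝓞 K),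
        (rankinSelbergLocalFactorInv f χ v s)⁻¹ =
      (1 - w * cuspCoeff f p * (p : ℂ) ^ (-s) +
          (if p ∣ N then 0 else (p : ℂ)) * w ^ 2 * ((p : ℂ) ^ (-s)) ^ 2)⁻¹ *
        (1 - w * κ p * cuspCoeff f p * (p : ℂ) ^ (-s) +
          (if p ∣ N then 0 else (p : ℂ)) * (w * κ p) ^ 2 * ((p : ℂ) ^ (-s)) ^ 2)⁻¹ := by
  set S := HeightOneSpectrum.asIdeal ⁻¹' primesOver (span {(p : ℤ)}) (𝓞 K) with hS
  set a : ℂ := cuspCoeff f p with ha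
  set e : ℂ := (if p ∣ N then 0 else (p : ℂ)) with he
  set X : ℂ := (p : ℂ) ^ (-s) with hX
  have hSn : S.ncard = (primesOver (span {(p : ℤ)}) (𝓞 K)).ncard := ncard_preimage_primesOver hp
  have hF : ∀ {d : ℕ}, d ≠ 0 → ∀ v ∈ S, absNorm v.asIdeal = p ^ d →
      (rankinSelbergLocalFactorInv f χ v s)⁻¹ =
        (1 - frobTracePow a e d * w ^ d * X ^ d + e ^ d * (w ^ d) ^ 2 * (X ^ d) ^ 2)⁻¹ := by
    intro d hd v hv hvd
    have hw : heckeValueAt χ v = w ^ d := by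
      rw [hval v hv, hvd, Nat.factorization_pow, Finsupp.smul_apply, hp.factorization_self,
        smul_eq_mul, mul_one]
    rw [rankinSelbergLocalFactorInv_of_absNorm_eq_pow f χ hp hd hvd s, hw]
  rcases Quadratic.primesOver_trichotomy_of_kronecker h2 κ hoddp htwo hp with
    ⟨hκ, hn, hN⟩ | ⟨hκ, hn, hN⟩ | ⟨hκ, hn, hN⟩
  · rw [hn] at hSn
    rw [Quadratic.finprod_mem_eq_of_ncard_eq_two hSn fun v hv =>
        hF one_ne_zero v hv (by rw [pow_one]; exact hN _ hv), frobTracePow_one, hκ]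
    congr 1 <;> exact congrArg Inv.inv (by ring)
  · rw [hn] at hSn
    rw [Quadratic.finprod_mem_eq_of_ncard_eq_one hSn fun v hv => hF two_ne_zero v hv (hN _ hv),
      frobTracePow_two, hκ, ← mul_inv]
    exact congrArg Inv.inv (by ring)
  · rw [hn] at hSn
    rw [Quadratic.finprod_mem_eq_of_ncard_eq_one hSn fun v hv =>
        hF one_ne_zero v hv (by rw [pow_one]; exact hN _ hv), frobTracePow_one, hκ,
      show (1 - w * 0 * a * X + e * (w * 0) ^ 2 * X ^ 2 : ℂ) = 1 by ring, inv_one, mul_one]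
    exact congrArg Inv.inv (by ring)

end Port

/-! ## Arithmetic of `d₁ d₂ = d_K c²` -/

section Arith

/-- An odd prime square never divides a fundamental discriminant; `p² ∣ d` forces `p = 2`.
[folklore] -/
private theorem eq_two_of_sq_dvd_fundamental' {d : ℤ}
    (hfund : (d % 4 = 1 ∧ Squarefree d ∧ d ≠ 1) ∨
      (4 ∣ d ∧ (d / 4 % 4 = 2 ∨ d / 4 % 4 = 3) ∧ Squarefree (d / 4)))
    {p : ℕ} (hp : p.Prime) (h : (p : ℤ) ^ 2 ∣ d) : p = 2 := by
  have hpu : ¬ IsUnit (p : ℤ) := by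
    rw [Int.isUnit_iff_natAbs_eq, Int.natAbs_natCast]; exact hp.one_lt.ne'
  rcases hfund with ⟨-, hsq, -⟩ | ⟨h4, -, hsq⟩
  · exact absurd (hsq _ (by rw [← sq]; exact h)) hpu
  · by_contra hp2
    obtain ⟨m, rfl⟩ := h4
    have hm4 : 4 * m / 4 = m := by omega
    rw [hm4] at hsq
    have hpi : Prime (p : ℤ) := Nat.prime_iff_prime_int.mp hp
    have hp4 : ¬ (p : ℤ) ∣ 4 := by
      intro hd
      have h' : (p : ℤ) ∣ 2 ^ 2 := by norm_num; exact hd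
      have h2 := Int.natAbs_dvd_natAbs.mpr (hpi.dvd_of_dvd_pow h')
      simp only [Int.natAbs_natCast, Int.reduceAbs, Nat.dvd_prime Nat.prime_two] at h2
      rcases h2 with h2 | h2
      · exact hp.one_lt.ne' h2
      · exact hp2 h2
    have hpm : (p : ℤ) ∣ m :=
      (hpi.dvd_or_dvd (dvd_trans (dvd_pow_self _ two_ne_zero) h)).resolve_left hp4
    obtain ⟨m₁, rfl⟩ := hpm
    have hp0 : (p : ℤ) ≠ 0 := by exact_mod_cast hp.ne_zero
    have h1 : (p : ℤ) ∣ 4 * m₁ := by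
      obtain ⟨e, he⟩ := h
      refine ⟨e, mul_left_cancel₀ hp0 ?_⟩
      calc (p : ℤ) * (4 * m₁) = 4 * (p * m₁) := by ring
        _ = p ^ 2 * e := he
        _ = p * (p * e) := by ring
    obtain ⟨m₂, rfl⟩ := (hpi.dvd_or_dvd h1).resolve_left hp4
    exact hpu (hsq _ ⟨m₂, by ring⟩)

/-- `16` does not divide a fundamental discriminant. [folklore] -/
private theorem not_sixteen_dvd_fundamental {d : ℤ}
    (hfund : (d % 4 = 1 ∧ Squarefree d ∧ d ≠ 1) ∨
      (4 ∣ d ∧ (d / 4 % 4 = 2 ∨ d / 4 % 4 = 3) ∧ Squarefree (d / 4))) : ¬ (16 : ℤ) ∣ d := by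
  rintro ⟨e, rfl⟩
  rcases hfund with ⟨h1, -, -⟩ | ⟨-, hm, -⟩ <;> omega

/-- A fundamental discriminant is non-zero. [folklore] -/
private theorem ne_zero_of_fundamental {d : ℤ}
    (hfund : (d % 4 = 1 ∧ Squarefree d ∧ d ≠ 1) ∨
      (4 ∣ d ∧ (d / 4 % 4 = 2 ∨ d / 4 % 4 = 3) ∧ Squarefree (d / 4))) : d ≠ 0 := by
  rintro rfl
  rcases hfund with ⟨h1, -, -⟩ | ⟨-, -, hsq⟩
  · norm_num at h1
  · simp at hsq

variable {d₁ d₂ dK : ℤ} {c : ℕ}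
  (hfund₁ : (d₁ % 4 = 1 ∧ Squarefree d₁ ∧ d₁ ≠ 1) ∨
    (4 ∣ d₁ ∧ (d₁ / 4 % 4 = 2 ∨ d₁ / 4 % 4 = 3) ∧ Squarefree (d₁ / 4)))
  (hfund₂ : (d₂ % 4 = 1 ∧ Squarefree d₂ ∧ d₂ ≠ 1) ∨
    (4 ∣ d₂ ∧ (d₂ / 4 % 4 = 2 ∨ d₂ / 4 % 4 = 3) ∧ Squarefree (d₂ / 4)))
  (hfundK : (dK % 4 = 1 ∧ Squarefree dK ∧ dK ≠ 1) ∨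
    (4 ∣ dK ∧ (dK / 4 % 4 = 2 ∨ dK / 4 % 4 = 3) ∧ Squarefree (dK / 4)))
  (hD : d₁ * d₂ = dK * (c : ℤ) ^ 2) {p : ℕ} (hp : p.Prime) (hpc : ¬ p ∣ c)
include hD hp hpc

/-- `p ∤ c`, `p ∣ d₁` ⟹ `p ∣ d_K` (from `d₁ d₂ = d_K c²`). [folklore] -/
private theorem dvd_discr_of_dvd (hpd₁ : (p : ℤ) ∣ d₁) : (p : ℤ) ∣ dK := by
  have hpi : Prime (p : ℤ) := Nat.prime_iff_prime_int.mp hp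
  have h : (p : ℤ) ∣ dK * (c : ℤ) ^ 2 := hD ▸ dvd_mul_of_dvd_left hpd₁ d₂
  rcases hpi.dvd_or_dvd h with h' | h'
  · exact h'
  · exact absurd (Int.natCast_dvd_natCast.mp (hpi.dvd_of_dvd_pow h')) hpc

include hfund₁ hfund₂ hfundK in
/-- `p ∤ c`, `p ∣ d₁` ⟹ `p ∤ d₂`: otherwise `p² ∣ d₁ d₂ = d_K c²` gives `p² ∣ d_K`, so `p = 2`,
and then `4 ∣ d₁`, `4 ∣ d₂`, `16 ∣ d_K`. [folklore] -/
private theorem not_dvd_of_dvd (hpd₁ : (p : ℤ) ∣ d₁) : ¬ (p : ℤ) ∣ d₂ := by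
  intro hpd₂
  have hpi : Prime (p : ℤ) := Nat.prime_iff_prime_int.mp hp
  have hp2 : (p : ℤ) ^ 2 ∣ dK * (c : ℤ) ^ 2 := by
    rw [← hD, sq]; exact mul_dvd_mul hpd₁ hpd₂
  have hcop : IsCoprime ((p : ℤ) ^ 2) ((c : ℤ) ^ 2) := by
    apply IsCoprime.pow
    exact (hpi.coprime_iff_not_dvd).mpr fun h ↦ hpc (Int.natCast_dvd_natCast.mp h)
  have hp2K : (p : ℤ) ^ 2 ∣ dK := hcop.dvd_of_dvd_mul_right hp2
  have hp2' : p = 2 := eq_two_of_sq_dvd_fundamental' hfundK hp hp2K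
  subst hp2'
  have h4₁ : (4 : ℤ) ∣ d₁ := by
    rcases hfund₁ with ⟨h1, -, -⟩ | ⟨h4, -, -⟩
    · omega
    · exact h4
  have h4₂ : (4 : ℤ) ∣ d₂ := by
    rcases hfund₂ with ⟨h1, -, -⟩ | ⟨h4, -, -⟩
    · omega
    · exact h4
  have h16 : (16 : ℤ) ∣ dK * (c : ℤ) ^ 2 := by
    rw [← hD, show (16 : ℤ) = 4 * 4 by norm_num]; exact mul_dvd_mul h4₁ h4₂
  have hcodd : ¬ (2 : ℤ) ∣ (c : ℤ) := fun h ↦ hpc (by exact_mod_cast h)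
  have hcop16 : IsCoprime (16 : ℤ) ((c : ℤ) ^ 2) := by
    rw [show (16 : ℤ) = 2 ^ 4 by norm_num]
    exact IsCoprime.pow (Int.prime_two.coprime_iff_not_dvd.mpr hcodd)
  exact not_sixteen_dvd_fundamental hfundK (hcop16.dvd_of_dvd_mul_right h16)

/-- **`(d₂ / p) = (d₁ / p) · (d_K / p)` at an odd prime `p ∤ c d₁`** (Jacobi symbols; from
`(d₁/p)(d₂/p) = (d_K c² / p)` and `(d₁/p)² = 1`). [folklore] -/
private theorem jacobiSym_d₂_eq (hpd₁ : ¬ (p : ℤ) ∣ d₁) : J(d₂ | p) = J(d₁ | p) * J(dK | p) := by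
  haveI : NeZero p := ⟨hp.ne_zero⟩
  have hpi : Prime (p : ℤ) := Nat.prime_iff_prime_int.mp hp
  have hprod : J(d₁ | p) * J(d₂ | p) = J(dK | p) := by
    rw [← jacobiSym.mul_left, hD, jacobiSym.mul_left, jacobiSym.pow_left]
    have hc : J((c : ℤ) | p) ^ 2 = 1 := by
      have hgcd : Int.gcd (c : ℤ) p = 1 := by
        rw [Int.gcd_natCast_natCast]
        exact (Nat.coprime_comm.mp ((Nat.Prime.coprime_iff_not_dvd hp).mpr hpc))
      rcases jacobiSym.eq_one_or_neg_one hgcd with h | h <;> rw [h] <;> norm_num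
    rw [hc, mul_one]
  have hsq : J(d₁ | p) * J(d₁ | p) = 1 := by
    have hgcd : Int.gcd d₁ p = 1 := by
      rw [← Int.isCoprime_iff_gcd_eq_one]
      exact (hpi.coprime_iff_not_dvd.mpr hpd₁).symm
    rcases jacobiSym.eq_one_or_neg_one hgcd with h | h <;> rw [h] <;> norm_num
  calc J(d₂ | p) = J(d₁ | p) * J(d₁ | p) * J(d₂ | p) := by rw [hsq, one_mul]
    _ = J(d₁ | p) * J(dK | p) := by rw [mul_assoc, hprod]

omit hD hpc in
/-- `J(d | p) = 0` when the prime `p` divides `d`. [folklore] -/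
private theorem jacobiSym_eq_zero_of_dvd {d : ℤ} (hpd : (p : ℤ) ∣ d) : J(d | p) = 0 := by
  haveI : NeZero p := ⟨hp.ne_zero⟩
  rw [jacobiSym.eq_zero_iff_not_coprime]
  intro hg
  have hcp : IsCoprime d (p : ℤ) := Int.isCoprime_iff_gcd_eq_one.mpr hg
  have hu : IsUnit (p : ℤ) := hcp.symm.isUnit_of_dvd' (dvd_refl _) hpd
  rw [Int.isUnit_iff_natAbs_eq, Int.natAbs_natCast] at hu
  exact hp.one_lt.ne' hu

end Arith


/-! ## The genus character over the places above `p` -/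

section Genus

variable {K : Type} [Field K] [NumberField K] {N : ℕ}

omit [NumberField K] in
/-- `p ∈ v` for a place `v` of `K` over `pℤ`. [folklore] -/
private theorem natCast_mem_of_mem_primesOver' {p : ℕ} {v : HeightOneSpectrum (𝓞 K)}
    (hv : v.asIdeal ∈ primesOver (span {(p : ℤ)}) (𝓞 K)) : ((p : ℕ) : 𝓞 K) ∈ v.asIdeal := by
  have h : (p : ℤ) ∈ v.asIdeal.under ℤ := by
    rw [← hv.2.over]
    exact Ideal.mem_span_singleton_self _
  rw [Ideal.mem_comap, map_natCast] at h
  exact h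

omit [NumberField K] in
/-- An integer coprime to `p` does not lie in a place over `p`. [folklore] -/
private theorem intCast_not_mem_of_isCoprime {p : ℕ} {v : HeightOneSpectrum (𝓞 K)}
    (hv : v.asIdeal ∈ primesOver (span {(p : ℤ)}) (𝓞 K)) {q : ℤ} (hq : IsCoprime (p : ℤ) q) :
    ((q : ℤ) : 𝓞 K) ∉ v.asIdeal := by
  intro hmem
  obtain ⟨a, b, hab⟩ := hq
  apply v.isPrime.ne_top
  rw [Ideal.eq_top_iff_one]
  have : ((a * p + b * q : ℤ) : 𝓞 K) ∈ v.asIdeal := by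
    push_cast
    exact v.asIdeal.add_mem (v.asIdeal.mul_mem_left _ (natCast_mem_of_mem_primesOver' hv))
      (v.asIdeal.mul_mem_left _ hmem)
  rwa [hab, Int.cast_one] at this

/-- `N(v) = p^k` with `k ≥ 1` for a place `v` over `pℤ`, and `k = N(v).factorization p`.
[cite: NeukirchANT1999, Ch. I §8 (8.2)] -/
private theorem exists_absNorm_eq_prime_pow {p : ℕ} (hp : p.Prime) {v : HeightOneSpectrum (𝓞 K)}
    (hv : v.asIdeal ∈ primesOver (span {(p : ℤ)}) (𝓞 K)) :
    ∃ k : ℕ, k ≠ 0 ∧ absNorm v.asIdeal = p ^ k ∧ (absNorm v.asIdeal).factorization p = k := by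
  obtain ⟨k, hk0, -, hℓ, hqk, hfac⟩ := absNorm_heightOneSpectrum_eq_pow v
  set ℓ := (absNorm v.asIdeal).minFac with hℓdef
  have hℓp : ℓ = p := by
    by_contra hne
    have hℓv : ((ℓ : ℕ) : 𝓞 K) ∈ v.asIdeal := by
      have h1 : ((absNorm v.asIdeal : ℕ) : 𝓞 K) ∈ v.asIdeal := Ideal.absNorm_mem v.asIdeal
      rw [hqk, Nat.cast_pow] at h1
      exact Ideal.IsPrime.mem_of_pow_mem v.isPrime _ h1
    have hcop : IsCoprime (p : ℤ) (ℓ : ℤ) :=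
      Nat.isCoprime_iff_coprime.mpr ((Nat.coprime_primes hp hℓ).mpr (Ne.symm hne))
    exact intCast_not_mem_of_isCoprime hv hcop (by exact_mod_cast hℓv)
  refine ⟨k, hk0.ne', by rw [hqk, hℓp], by rw [← hℓp]; exact hfac⟩

/-- The dyadic sign `χ₈'(d)^f` packaged: for `w = ±1` according as `d ≡ 1 (mod 8)` or not,
`(if d ≡ 1 (mod 8) ∨ f even then 1 else −1) = w^f`. [folklore] -/
private theorem ite_even_eq_pow (d : ℤ) (f : ℕ) :
    ((if d % 8 = 1 ∨ Even f then 1 else -1 : ℂ)) =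
      ((if d % 8 = 1 then 1 else -1 : ℤ) : ℂ) ^ f := by
  by_cases h8 : d % 8 = 1
  · simp [h8]
  · rcases Nat.even_or_odd f with hf | hf
    · simp [h8, hf, Even.neg_one_pow hf]
    · simp [h8, Nat.not_even_iff_odd.mpr hf, Odd.neg_one_pow hf]

/-- **Gross's factorisation, prime by prime on the Rankin–Selberg side.** Let `K` be a quadratic
field with Kronecker character `κ`, `d₁`, `d₂` fundamental discriminants with `d₁ d₂ = d_K c²`,
`χ_gal : Γ_K → ℂˣ` rational for `d₁` (the rational ring class character of conductor `c`
attached to `D = d₁ d₂`, Gross 2004 §2), `f ∈ S₂(Γ₀(N))` and `p` a prime. Then the product of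
the inverse Rankin–Selberg local factors (Galois currency) over the places `v ∣ p` of `K` is
`E(t₁(p)) · E(t₂(p))`, `E(t) = (1 − t a_p p^{−s} + e t² p^{−2s})⁻¹`, `e = p 𝟙_{p∤N}`, where
`tᵢ(p)` is the value at `p` of the Kronecker character of `ℚ(√dᵢ)`: `(dᵢ / p)` for odd `p`; for
`p = 2`: `0`, `+1`, `−1` as `dᵢ` is even, `≡ 1`, `≡ 5 (mod 8)` — i.e. the `p`-Euler factors of
`L(A₁, s) L(A₂, s)` for the twists `Aᵢ = E^{(dᵢ)}` (Gross: "`L(f, χ, s) = L(A₁, s) L(A₂, s)`").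
[cite: Gross2004, §2 p. 40 ("L(f, χ, s) = L(A₁, s)L(A₂, s)") and §3, §13]
[cite: NeukirchANT1999, Ch. I §8 Prop. (8.5) and Ch. VII (10.4) (iv)] -/
theorem finprod_rankinSelbergLocalFactorInv_genus (h2 : finrank ℚ K = 2) {M : ℕ}
    (κ : DirichletCharacter ℂ M)
    (hoddp : ∀ p : ℕ, p.Prime → p ≠ 2 → κ p = (J(NumberField.discr K | p) : ℂ))
    (htwo : κ 2 = if NumberField.discr K % 8 = 1 then 1
      else if NumberField.discr K % 8 = 5 then -1 else 0)
    {χgal : absoluteGaloisGroup K →ₜ* ℂˣ} {d₁ d₂ : ℤ} (hχ : IsRationalCharacterFor χgal d₁)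
    (hfund₁ : (d₁ % 4 = 1 ∧ Squarefree d₁ ∧ d₁ ≠ 1) ∨
      (4 ∣ d₁ ∧ (d₁ / 4 % 4 = 2 ∨ d₁ / 4 % 4 = 3) ∧ Squarefree (d₁ / 4)))
    (hfund₂ : (d₂ % 4 = 1 ∧ Squarefree d₂ ∧ d₂ ≠ 1) ∨
      (4 ∣ d₂ ∧ (d₂ / 4 % 4 = 2 ∨ d₂ / 4 % 4 = 3) ∧ Squarefree (d₂ / 4)))
    {c : ℕ} (hD : d₁ * d₂ = NumberField.discr K * (c : ℤ) ^ 2) (f : CuspForm (Gamma0 N) 2)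
    {p : ℕ} (hp : p.Prime) (s : ℂ) (t₁ t₂ : ℤ)
    (ht₁ : t₁ = if p = 2 then (if (2 : ℤ) ∣ d₁ then 0 else if d₁ % 8 = 1 then 1 else -1)
      else J(d₁ | p))
    (ht₂ : t₂ = if p = 2 then (if (2 : ℤ) ∣ d₂ then 0 else if d₂ % 8 = 1 then 1 else -1)
      else J(d₂ | p)) :
    ∏ᶠ v ∈ HeightOneSpectrum.asIdeal ⁻¹' primesOver (span {(p : ℤ)}) (𝓞 K),
        (rankinSelbergLocalFactorInv f χgal v s)⁻¹ =
      (1 - (t₁ : ℂ) * cuspCoeff f p * (p : ℂ) ^ (-s) +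
          (if p ∣ N then 0 else (p : ℂ)) * (t₁ : ℂ) ^ 2 * ((p : ℂ) ^ (-s)) ^ 2)⁻¹ *
        (1 - (t₂ : ℂ) * cuspCoeff f p * (p : ℂ) ^ (-s) +
          (if p ∣ N then 0 else (p : ℂ)) * (t₂ : ℂ) ^ 2 * ((p : ℂ) ^ (-s)) ^ 2)⁻¹ := by
  classical
  have hpi : Prime (p : ℤ) := Nat.prime_iff_prime_int.mp hp
  have hfundK := Quadratic.isFundamentalDiscriminant_discr (K := K) h2
  have hd4 := Quadratic.discr_emod_four (K := K) h2
  have hd₁0 : d₁ ≠ 0 := ne_zero_of_fundamental hfund₁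
  have hd₂0 : d₂ ≠ 0 := ne_zero_of_fundamental hfund₂
  -- `χ_gal` is also rational for `d₂` (`√d₂ = c√d_K/√d₁`)
  obtain ⟨δ, -, hδsq⟩ := Quadratic.exists_not_mem_range_sq_eq_discr (K := K) h2
  have hχ₂ : IsRationalCharacterFor χgal d₂ := by
    refine hχ.of_mul_eq_sq hd₁0 hd₂0 (δ := (c : K) * δ) ?_
    rw [mul_pow, hδsq, hD]
    simp [mul_comm]
  -- the shape `E(w) E(wκ(p))` from the values `w^{f_v}`, and the reduction to the two disjuncts
  set E : ℂ → ℂ := fun w ↦ (1 - w * cuspCoeff f p * (p : ℂ) ^ (-s) +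
    (if p ∣ N then 0 else (p : ℂ)) * w ^ 2 * ((p : ℂ) ^ (-s)) ^ 2)⁻¹ with hE
  have key : ∀ w : ℂ, (∀ v : HeightOneSpectrum (𝓞 K),
      v.asIdeal ∈ primesOver (span {(p : ℤ)}) (𝓞 K) →
        heckeValueAt χgal v = w ^ (absNorm v.asIdeal).factorization p) →
      ((w = t₁ ∧ w * κ p = t₂) ∨ (w = t₂ ∧ w * κ p = t₁)) →
      ∏ᶠ v ∈ HeightOneSpectrum.asIdeal ⁻¹' primesOver (span {(p : ℤ)}) (𝓞 K),
          (rankinSelbergLocalFactorInv f χgal v s)⁻¹ = E t₁ * E t₂ := by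
    intro w hval hcases
    rw [finprod_rankinSelbergLocalFactorInv_eq_of_heckeValueAt h2 κ hoddp htwo f χgal hp w s hval]
    change E w * E (w * κ p) = E t₁ * E t₂
    rcases hcases with ⟨h1, h2'⟩ | ⟨h1, h2'⟩
    · rw [h1, ← h2', h1]
    · rw [mul_comm (E (t₁ : ℂ)), h1, ← h2', h1]
  change _ = E t₁ * E t₂
  by_cases hpc : p ∣ c
  · -- above the conductor: all values vanish, and `t₁ = t₂ = 0`
    have hpd₁ : (p : ℤ) ∣ d₁ := Int.dvd_of_prime_dvd_conductor hd4 hfund₁ hfund₂ hD hp hpc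
    have hpd₂ : (p : ℤ) ∣ d₂ :=
      Int.dvd_of_prime_dvd_conductor hd4 hfund₂ hfund₁ (by rw [mul_comm]; exact hD) hp hpc
    have ht₁0 : t₁ = 0 := by
      rw [ht₁]
      by_cases hp2 : p = 2
      · subst hp2
        have h : (2 : ℤ) ∣ d₁ := by exact_mod_cast hpd₁
        rw [if_pos rfl, if_pos h]
      · rw [if_neg hp2]; exact jacobiSym_eq_zero_of_dvd hp hpd₁
    have ht₂0 : t₂ = 0 := by
      rw [ht₂]
      by_cases hp2 : p = 2
      · subst hp2
        have h : (2 : ℤ) ∣ d₂ := by exact_mod_cast hpd₂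
        rw [if_pos rfl, if_pos h]
      · rw [if_neg hp2]; exact jacobiSym_eq_zero_of_dvd hp hpd₂
    refine key 0 (fun v hv ↦ ?_) (Or.inl ⟨by rw [ht₁0]; simp, by rw [ht₂0]; simp⟩)
    obtain ⟨k, hk0, -, hfac⟩ := exists_absNorm_eq_prime_pow hp hv
    rw [hfac, zero_pow hk0]
    exact heckeValueAt_eq_zero_of_isRationalCharacterFor_of_dvd_conductor h2 hχ hfund₁ hfund₂ hD hp
      hpc v (natCast_mem_of_mem_primesOver' hv)
  -- below: `p ∤ c`
  by_cases hp2 : p = 2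
  · subst hp2
    rw [if_pos rfl] at ht₁ ht₂
    by_cases h2d₁ : (2 : ℤ) ∣ d₁
    · -- `d₁` even: `2 ∣ d_K` (ramified), `d₂` odd; read the value on `√d₂`
      have h2K : (2 : ℤ) ∣ NumberField.discr K := dvd_discr_of_dvd hD Nat.prime_two hpc h2d₁
      have h2d₂ : ¬ (2 : ℤ) ∣ d₂ := not_dvd_of_dvd hfund₁ hfund₂ hfundK hD Nat.prime_two hpc h2d₁
      have hd₂4 : d₂ % 4 = 1 := by
        rcases hfund₂ with ⟨h1, -, -⟩ | ⟨h4, -, -⟩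
        · exact h1
        · exact absurd (dvd_trans (by norm_num) h4) h2d₂
      have hκ : κ ((2 : ℕ) : ZMod M) = 0 := by
        rw [Nat.cast_ofNat, htwo, if_neg (by omega), if_neg (by omega)]
      rw [if_pos h2d₁] at ht₁
      rw [if_neg h2d₂] at ht₂
      refine key ((if d₂ % 8 = 1 then 1 else -1 : ℤ) : ℂ) (fun v hv ↦ ?_)
        (Or.inr ⟨by rw [ht₂], by rw [hκ, mul_zero, ht₁, Int.cast_zero]⟩)
      obtain ⟨k, hk0, hNv, hfac⟩ := exists_absNorm_eq_prime_pow Nat.prime_two hv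
      rw [heckeValueAt_of_isRationalCharacterFor_two hχ₂ (k := d₂ / 4) (by omega) v
        (by exact_mod_cast natCast_mem_of_mem_primesOver' hv) (f := k)
        (by rw [HeightOneSpectrum.residueCard, hNv]), hfac, ite_even_eq_pow]
    · -- `d₁` odd: read the value on `√d₁`
      have hd₁4 : d₁ % 4 = 1 := by
        rcases hfund₁ with ⟨h1, -, -⟩ | ⟨h4, -, -⟩
        · exact h1
        · exact absurd (dvd_trans (by norm_num) h4) h2d₁
      rw [if_neg h2d₁] at ht₁
      have hval : ∀ v : HeightOneSpectrum (𝓞 K), v.asIdeal ∈ primesOver (span {((2 : ℕ) : ℤ)}) (𝓞 K) →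
          heckeValueAt χgal v = ((if d₁ % 8 = 1 then 1 else -1 : ℤ) : ℂ) ^
            (absNorm v.asIdeal).factorization 2 := by
        intro v hv
        obtain ⟨k, hk0, hNv, hfac⟩ := exists_absNorm_eq_prime_pow Nat.prime_two hv
        rw [heckeValueAt_of_isRationalCharacterFor_two hχ (k := d₁ / 4) (by omega) v
          (by exact_mod_cast natCast_mem_of_mem_primesOver' hv) (f := k)
          (by rw [HeightOneSpectrum.residueCard, hNv]), hfac, ite_even_eq_pow]
      refine key _ hval (Or.inl ⟨by rw [ht₁], ?_⟩)
      by_cases h2d₂ : (2 : ℤ) ∣ d₂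
      · -- `d₂` even: `2 ∣ d_K`, `κ(2) = 0 = t₂`
        have h2K : (2 : ℤ) ∣ NumberField.discr K :=
          dvd_discr_of_dvd (by rw [mul_comm]; exact hD) Nat.prime_two hpc h2d₂
        have hκ : κ ((2 : ℕ) : ZMod M) = 0 := by
          rw [Nat.cast_ofNat, htwo, if_neg (by omega), if_neg (by omega)]
        rw [hκ, mul_zero, ht₂, if_pos h2d₂, Int.cast_zero]
      · -- `d₂` odd: `d_K` odd, `c` odd, `d₁ d₂ ≡ d_K (mod 8)`
        rw [if_neg h2d₂] at ht₂
        have hd₂4 : d₂ % 4 = 1 := by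
          rcases hfund₂ with ⟨h1, -, -⟩ | ⟨h4, -, -⟩
          · exact h1
          · exact absurd (dvd_trans (by norm_num) h4) h2d₂
        have hcodd : ¬ (2 : ℤ) ∣ (c : ℤ) := fun h ↦ hpc (by exact_mod_cast h)
        have hc2 : ((c : ℤ) ^ 2) % 8 = 1 := by
          have hc' : (c : ℤ) % 2 = 1 := by omega
          have : ∃ j : ℤ, (c : ℤ) = 2 * j + 1 := ⟨(c : ℤ) / 2, by omega⟩
          obtain ⟨j, hj⟩ := this
          rw [hj, show (2 * j + 1) ^ 2 = 1 + 8 * (j * (j + 1) / 2) by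
            have h2 : (2 : ℤ) ∣ j * (j + 1) := by
              rcases Int.even_or_odd j with ⟨i, hi⟩ | ⟨i, hi⟩
              · exact ⟨i * (j + 1), by rw [hi]; ring⟩
              · exact ⟨j * (i + 1), by rw [hi]; ring⟩
            have := Int.mul_ediv_cancel' h2
            linarith [this]]
          rw [Int.add_mul_emod_self_left]; norm_num
        have hmod : (d₁ * d₂) % 8 = NumberField.discr K % 8 := by
          rw [hD, Int.mul_emod, hc2, mul_one, Int.emod_emod_of_dvd _ (dvd_refl _)]
        rw [Int.mul_emod] at hmod
        have hd₁8 : d₁ % 8 = 1 ∨ d₁ % 8 = 5 := by omega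
        have hd₂8 : d₂ % 8 = 1 ∨ d₂ % 8 = 5 := by omega
        rw [ht₂, Nat.cast_ofNat, htwo]
        rcases hd₁8 with h1 | h1 <;> rcases hd₂8 with h2' | h2' <;>
          · rw [h1, h2'] at hmod
            norm_num at hmod
            simp [h1, h2', ← hmod]
  · -- odd `p ∤ c`
    rw [if_neg hp2] at ht₁ ht₂
    have h2cop : IsCoprime (p : ℤ) 2 :=
      Nat.isCoprime_iff_coprime.mpr ((Nat.coprime_primes hp Nat.prime_two).mpr hp2)
    by_cases hpd₁ : (p : ℤ) ∣ d₁
    · -- `p ∣ d₁`: ramified in `K`, `p ∤ d₂`; read the value on `√d₂`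
      have hpK : (p : ℤ) ∣ NumberField.discr K := dvd_discr_of_dvd hD hp hpc hpd₁
      have hpd₂ : ¬ (p : ℤ) ∣ d₂ := not_dvd_of_dvd hfund₁ hfund₂ hfundK hD hp hpc hpd₁
      have hκ : κ p = 0 := by rw [hoddp p hp hp2, jacobiSym_eq_zero_of_dvd hp hpK, Int.cast_zero]
      refine key (J(d₂ | p) : ℂ) (fun v hv ↦ ?_)
        (Or.inr ⟨by rw [ht₂], by rw [hκ, mul_zero, ht₁, jacobiSym_eq_zero_of_dvd hp hpd₁, Int.cast_zero]⟩)
      obtain ⟨k, hk0, hNv, hfac⟩ := exists_absNorm_eq_prime_pow hp hv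
      rw [hfac, heckeValueAt_eq_jacobiSym_of_isRationalCharacterFor hχ₂ v
        (by exact_mod_cast intCast_not_mem_of_isCoprime hv h2cop)
        (intCast_not_mem_of_isCoprime hv (hpi.coprime_iff_not_dvd.mpr hpd₂)),
        HeightOneSpectrum.residueCard, hNv, jacobiSym.pow_right, Int.cast_pow]
    · -- `p ∤ d₁`: read the value on `√d₁`; `t₂ = (d₂/p) = (d₁/p)(d_K/p)`
      refine key (J(d₁ | p) : ℂ) (fun v hv ↦ ?_) (Or.inl ⟨by rw [ht₁], ?_⟩)
      · obtain ⟨k, hk0, hNv, hfac⟩ := exists_absNorm_eq_prime_pow hp hv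
        rw [hfac, heckeValueAt_eq_jacobiSym_of_isRationalCharacterFor hχ v
          (by exact_mod_cast intCast_not_mem_of_isCoprime hv h2cop)
          (intCast_not_mem_of_isCoprime hv (hpi.coprime_iff_not_dvd.mpr hpd₁)),
          HeightOneSpectrum.residueCard, hNv, jacobiSym.pow_right, Int.cast_pow]
      · rw [hoddp p hp hp2, ht₂, jacobiSym_d₂_eq hD hp hpc hpd₁, Int.cast_mul]

end Genus

end Gross2004

end Literature.NumberTheory.EllipticCurves

end
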